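import Summits.CriticalPhenomena.PercolationContinuityZ3.Theorems.PercNearOneGluingNoHeavyLowerTailSunflowerMultiPetalDemotion
import Summits.CriticalPhenomena.PercolationContinuityZ3.Theorems.PercNearOneGluingNoHeavyLowerTailSunflowerMultiPetalExtension
import HarnessLib
import HarnessLib.Audit

/-!
# `NoHeavyLowerTail` (crux stmt-CriticalPhenomena-4575), abstract sunflower cubic, `k` petals: the SATURATION NORMAL FORM of ★ₖ and of Conjecture G —
# `PartitionLemmaK` / `FlipPartitionLemmaK` hold iff they hold for SATURATED structures (no kernel demotion, no bottom extension available)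

Support file (seat `prim-l12-p2` gen 32; `--supports stmt-CriticalPhenomena-4575`; companion of `…SunflowerMultiPetalDemotion` (`MSunflower.demote`, `ZKflip_demote_le`,
`ZKflip_demote_le_self`) and `…SunflowerMultiPetalExtension` (`MSunflower.extend`, `ZKflip_extend_le`, `ZKflip_extend_le_self`); the `k = 3`, flip-free statement is
prim-ineq-gen-2 g19's `partitionLemmaH_iff_saturated`).  Everything here is PROVED.  Memo: run/shared/lean/prim/prim-l12/prim-l12-p2/FINDING-g32.md §3.

* `MSunflower.KernelMovable M i₀` / `BottomMovable M i₀` — a legal move exists at the nonempty set `M` towards colour `i₀`; `IsSaturatedK` — no move exists.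
* `satMeasureK = #kernel + #bottom`; `satMeasureK_demote`, `satMeasureK_extend` (each move lowers it by one).
* `ZKflip_demote_le_all`, `ZKflip_extend_le_all` — the moves never increase any `ZKflip D` (all `D`: the generic case and the corner `D = M` combined).
* **`exists_saturatedK_ZKflip_le`**: for every `F` there is a SATURATED `G` (same `k`, same ground type) with `G.ZKflip D ≤ F.ZKflip D` for every `D`.
* **`flipPartitionLemmaK_iff_saturated`**, **`partitionLemmaK_iff_saturated`**: Conjecture G, resp. ★ₖ, is equivalent to its restriction to saturated structures.
With the composition theorems (p360158: a composite structure expands over flipped coefficients of a smaller quotient) a minimal counterexample to G is a SATURATED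
PRIME structure; on ≤ 6 points those with a rainbow have `ZK ≥ 12`, and the ones without any one-point certificate have `ZK ≥ 48` (memo §4).
-/

namespace Summit.CriticalPhenomena.PercolationContinuityZ3.Theorems.SunflowerPartition

open Finset

variable {α : Type*} [DecidableEq α]

namespace MSunflower

variable {k : ℕ} (F : MSunflower k α)

/-! ## Saturation: iterating the two moves -/

section Saturation

variable [Fintype α]

/-- A legal KERNEL DEMOTION exists at `(M, i₀)`. [this work] -/
def KernelMovable (M : Finset α) (i₀ : Fin k) : Prop :=
  M ∈ F.A ∧ M.Nonempty ∧ (∀ T : Finset α, T ⊂ M → T ∉ F.A) ∧ (∀ T : Finset α, T ⊂ M → ∀ j, j ≠ i₀ → T ∉ F.V j)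

/-- A legal BOTTOM EXTENSION exists at `(M, i₀)`. [this work] -/
def BottomMovable (M : Finset α) (i₀ : Fin k) : Prop :=
  (∀ j, M ∉ F.V j) ∧ M.Nonempty ∧ (∀ T : Finset α, M ⊂ T → T ∈ F.V i₀)

/-- SATURATED (for the two moves): no nonempty kernel set can be demoted and no nonempty bottom set can be extended. [this work] -/
def IsSaturatedK : Prop := (∀ M i₀, ¬ F.KernelMovable M i₀) ∧ (∀ M i₀, ¬ F.BottomMovable M i₀)

/-- The descent measure `#kernel + #bottom`. [this work] -/
def satMeasureK : ℕ := F.A.card + (univ.filter fun S : Finset α => ∀ j, S ∉ F.V j).card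

/-- Kernel demotion lowers the measure by one. [this work] -/
theorem satMeasureK_demote (M : Finset α) (i₀ : Fin k) (hmin : ∀ T : Finset α, T ⊂ M → T ∉ F.A)
    (hlow : ∀ T : Finset α, T ⊂ M → ∀ j, j ≠ i₀ → T ∉ F.V j) (hM : M ∈ F.A) :
    (F.demote M i₀ hmin hlow).satMeasureK + 1 = F.satMeasureK := by
  unfold satMeasureK
  have hA : (F.demote M i₀ hmin hlow).A = F.A.erase M := rfl
  have hbot : (univ.filter fun S : Finset α => ∀ j, S ∉ (F.demote M i₀ hmin hlow).V j)
      = (univ.filter fun S : Finset α => ∀ j, S ∉ F.V j) := by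
    ext S
    simp only [mem_filter, mem_univ, true_and]
    constructor
    · intro h j hS
      by_cases hSM : S = M
      · subst hSM
        have : S ∈ (F.demote S i₀ hmin hlow).V i₀ := by
          show S ∈ (if i₀ = i₀ then F.V i₀ else (F.V i₀).erase S)
          rw [if_pos rfl]; exact F.A_sub i₀ hM
        exact h i₀ this
      · by_cases hj : j = i₀
        · subst hj
          have : S ∈ (F.demote M j hmin hlow).V j := by
            show S ∈ (if j = j then F.V j else (F.V j).erase M)
            rw [if_pos rfl]; exact hS
          exact h j this
        · have : S ∈ (F.demote M i₀ hmin hlow).V j := by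
            show S ∈ (if j = i₀ then F.V j else (F.V j).erase M)
            rw [if_neg hj]; exact mem_erase.2 ⟨hSM, hS⟩
          exact h j this
    · intro h j hS
      by_cases hj : j = i₀
      · subst hj
        have hS' : S ∈ F.V j := by
          have : S ∈ (if j = j then F.V j else (F.V j).erase M) := hS
          rwa [if_pos rfl] at this
        exact h j hS'
      · have hS' : S ∈ (F.V j).erase M := by
          have : S ∈ (if j = i₀ then F.V j else (F.V j).erase M) := hS
          rwa [if_neg hj] at this
        exact h j (mem_erase.1 hS').2
  rw [hA, hbot, card_erase_of_mem hM]
  have := card_pos.2 ⟨M, hM⟩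
  omega

/-- Bottom extension lowers the measure by one. [this work] -/
theorem satMeasureK_extend (M : Finset α) (i₀ : Fin k) (hsup : ∀ T : Finset α, M ⊂ T → T ∈ F.V i₀) (hB : ∀ j, M ∉ F.V j) :
    (F.extend M i₀ hsup hB).satMeasureK + 1 = F.satMeasureK := by
  unfold satMeasureK
  have hA : (F.extend M i₀ hsup hB).A = F.A := rfl
  have hbot : (univ.filter fun S : Finset α => ∀ j, S ∉ (F.extend M i₀ hsup hB).V j)
      = (univ.filter fun S : Finset α => ∀ j, S ∉ F.V j).erase M := by
    ext S
    simp only [mem_filter, mem_univ, true_and, mem_erase]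
    constructor
    · intro h
      have hSM : S ≠ M := by
        rintro rfl
        have : S ∈ (F.extend S i₀ hsup hB).V i₀ := by
          show S ∈ (if i₀ = i₀ then insert S (F.V i₀) else F.V i₀)
          rw [if_pos rfl]; exact mem_insert_self S _
        exact h i₀ this
      refine ⟨hSM, fun j hS => ?_⟩
      by_cases hj : j = i₀
      · subst hj
        have : S ∈ (F.extend M j hsup hB).V j := by
          show S ∈ (if j = j then insert M (F.V j) else F.V j)
          rw [if_pos rfl]; exact mem_insert.2 (Or.inr hS)
        exact h j this
      · have : S ∈ (F.extend M i₀ hsup hB).V j := by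
          show S ∈ (if j = i₀ then insert M (F.V j) else F.V j)
          rw [if_neg hj]; exact hS
        exact h j this
    · rintro ⟨hSM, h⟩ j hS
      by_cases hj : j = i₀
      · subst hj
        have hS' : S ∈ insert M (F.V j) := by
          have : S ∈ (if j = j then insert M (F.V j) else F.V j) := hS
          rwa [if_pos rfl] at this
        rcases mem_insert.1 hS' with h' | h'
        · exact hSM h'
        · exact h j h'
      · have hS' : S ∈ F.V j := by
          have : S ∈ (if j = i₀ then insert M (F.V j) else F.V j) := hS
          rwa [if_neg hj] at this
        exact h j hS'
  have hMb : M ∈ (univ.filter fun S : Finset α => ∀ j, S ∉ F.V j) := mem_filter.2 ⟨mem_univ _, hB⟩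
  rw [hA, hbot, card_erase_of_mem hMb]
  have := card_pos.2 ⟨M, hMb⟩
  omega

/-- Kernel demotion never increases ANY flipped functional (both cases `D ≠ M` and `D = M`). [this work] -/
theorem ZKflip_demote_le_all (M : Finset α) (i₀ : Fin k) (hmin : ∀ T : Finset α, T ⊂ M → T ∉ F.A)
    (hlow : ∀ T : Finset α, T ⊂ M → ∀ j, j ≠ i₀ → T ∉ F.V j) (hM : M ∈ F.A) (hMne : M.Nonempty) (D : Finset α) :
    (F.demote M i₀ hmin hlow).ZKflip D ≤ F.ZKflip D := by
  by_cases hX : (symmDiff M D).Nonempty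
  · exact F.ZKflip_demote_le M i₀ hmin hlow hM D hX
  · rw [not_nonempty_iff_eq_empty, symmDiff_eq_empty] at hX
    subst hX
    exact F.ZKflip_demote_le_self M i₀ hmin hlow hM hMne

/-- Bottom extension never increases ANY flipped functional. [this work] -/
theorem ZKflip_extend_le_all (M : Finset α) (i₀ : Fin k) (hsup : ∀ T : Finset α, M ⊂ T → T ∈ F.V i₀) (hB : ∀ j, M ∉ F.V j)
    (hMne : M.Nonempty) (D : Finset α) : (F.extend M i₀ hsup hB).ZKflip D ≤ F.ZKflip D := by
  by_cases hX : (symmDiff M D).Nonempty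
  · exact F.ZKflip_extend_le M i₀ hsup hB D hX
  · rw [not_nonempty_iff_eq_empty, symmDiff_eq_empty] at hX
    subst hX
    exact F.ZKflip_extend_le_self M i₀ hsup hB hMne

/-- **SATURATION**: every structure can be driven to a saturated one without increasing any flipped functional (hence without increasing `ZK = ZKflip ∅`). [this work] -/
theorem exists_saturatedK_ZKflip_le : ∃ G : MSunflower k α, G.IsSaturatedK ∧ ∀ D, G.ZKflip D ≤ F.ZKflip D := by
  suffices h : ∀ n (F : MSunflower k α), F.satMeasureK = n → ∃ G : MSunflower k α, G.IsSaturatedK ∧ ∀ D, G.ZKflip D ≤ F.ZKflip D from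
    h _ F rfl
  intro n
  induction n using Nat.strong_induction_on with
  | _ n ih =>
    intro F hF
    by_cases hs : F.IsSaturatedK
    · exact ⟨F, hs, fun D => le_refl _⟩
    · unfold IsSaturatedK at hs
      rw [not_and_or] at hs
      rcases hs with hs | hs
      · push Not at hs
        obtain ⟨M, i₀, hM, hMne, hmin, hlow⟩ := hs
        have hlt : (F.demote M i₀ hmin hlow).satMeasureK < n := by
          have := F.satMeasureK_demote M i₀ hmin hlow hM; omega
        obtain ⟨G, hG, hGle⟩ := ih _ hlt (F.demote M i₀ hmin hlow) rfl
        exact ⟨G, hG, fun D => le_trans (hGle D) (F.ZKflip_demote_le_all M i₀ hmin hlow hM hMne D)⟩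
      · push Not at hs
        obtain ⟨M, i₀, hB, hMne, hsup⟩ := hs
        have hlt : (F.extend M i₀ hsup hB).satMeasureK < n := by
          have := F.satMeasureK_extend M i₀ hsup hB; omega
        obtain ⟨G, hG, hGle⟩ := ih _ hlt (F.extend M i₀ hsup hB) rfl
        exact ⟨G, hG, fun D => le_trans (hGle D) (F.ZKflip_extend_le_all M i₀ hsup hB hMne D)⟩

end Saturation

end MSunflower

/-- **SATURATION NORMAL FORM OF CONJECTURE G**: `FlipPartitionLemmaK` holds iff it holds for SATURATED structures. [this work] -/
theorem flipPartitionLemmaK_iff_saturated :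
    FlipPartitionLemmaK ↔ ∀ (k : ℕ) (α : Type) [Fintype α] [DecidableEq α] (F : MSunflower k α), F.IsSaturatedK → ∀ D, 0 ≤ F.ZKflip D := by
  constructor
  · intro h k α _ _ F _ D; exact h k α F D
  · intro h k α _ _ F D
    obtain ⟨G, hG, hle⟩ := F.exists_saturatedK_ZKflip_le
    exact le_trans (h k α G hG D) (hle D)

/-- **SATURATION NORMAL FORM OF ★ₖ**: `PartitionLemmaK` holds iff `0 ≤ ZK` for every SATURATED structure. [this work] -/
theorem partitionLemmaK_iff_saturated :
    PartitionLemmaK ↔ ∀ (k : ℕ) (α : Type) [Fintype α] [DecidableEq α] (F : MSunflower k α), F.IsSaturatedK → 0 ≤ F.ZK := by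
  constructor
  · intro h k α _ _ F _; exact h k α F
  · intro h k α _ _ F
    obtain ⟨G, hG, hle⟩ := F.exists_saturatedK_ZKflip_le
    have h1 := hle ∅
    rw [MSunflower.ZKflip_empty, MSunflower.ZKflip_empty] at h1
    exact le_trans (h k α G hG) h1

end Summit.CriticalPhenomena.PercolationContinuityZ3.Theorems.SunflowerPartition
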